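import Literature.MathematicalPhysics.QuantumFieldTheory.Balaban1983to89.B4Green242Bridge

/-!
# `Balaban1983to89.B4Lemma24HolderRateUnif` — [B4] Lemma 2.4 (2.36) (the Hölder quotient of `∂^{L^{−j}}_μG_j(□)Q_j^*`)
# with the PRINTED QUANTIFIER ORDER «There exist positive constants c₀, δ₀, and for α < 1, there exists a constant c₁»:
# ONE decay rate for ALL Hölder exponents `0 ≤ α < 1`, an `α`-dependent constant — the tree's chain
# `B4StripSumsHolder.holder248_stripRegular → hkernel248_decay → B4Green242Bridge.K_holder_decay →
# greenBoxQ_holder_decay_236(_inv)` RE-THREADED (`_unif` twins; proofs = the originals with the witnesses reordered)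

statement-level skeleton of published theorems with citation tags; proofs where landed; nothing here is a claim about the Yang–Mills mass gap

T. Bałaban, *Regularity and decay of lattice Green's functions*, Commun. Math. Phys. **89** (1983) 571–597
[Balaban1983RegularityDecay] («[B4]» = [3] of CMP 96).  PDF held `paper:balaban1983-cmp89-regularity-decay` (journal page
= PDF page + 570): p. 573 [PDF 3] (Theorem, (1.9)), p. 582 [PDF 12] (Lemma 2.4, (2.35)–(2.37)), pp. 585–586 (2.49)–(2.51).

CITATION HEADER (lean-in-tree rule).  Cell `lit-balaban` (HOME `run/shared/lean/pub/lit-balaban/`), unit `lit-balaban-r03`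
gen 13 (B6 fold owner; free-target protocol G.5-34(d): rows **B4.Lem2.4** / **B4.Thm@573** cells, owner r01 notified — and
the consumer row **B6.Prop2.2**, whose census typing `B6.Prop22Printed` asks ONE rate `δ₀` for all `α`).  A NEW LEAF on top
of the pre-cell pub-balaban lineage files `…B4StripSumsHolder` (root: `uniformStrip_holds`, `stripRegular_GH`, `boundGH`,
`holder248_stripRegular`, `hkernel248_decay`), `…B4Green242Bridge` (`K_holder_dd`, `K_holder_decay`, `greenBoxQ_holder_src`,
`greenBoxQ_deriv_decay_235`, `greenBoxQ_holder_decay_236(_inv)`, `C235`, `C236`, `boxOp_mul_inv`), `…B4Green244` (`K_decay`,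
`green244_kernelForm`) and `…B4ContourShift` (`latticeKernel_decay`); everything consumed BY NAME; NOTHING existing is
modified (the per-`α` theorems stay as they are; the twins below carry the suffix `_unif`).  THEOREMS ONLY — no definition,
no `def … : Prop` fact.

WHAT IS PRINTED.  p. 582: «**Lemma 2.4.** There exist positive constants c₀, δ₀, and for α < 1, there exists a constant c₁,
such that |(G_j(□)Q_j^*)(x, y)|, |(∂^{L^{−j}}_μG_j(□)Q_j^*)(x, y)| ≤ c₀e^{−δ₀|x−y|}, (2.35)
|x − x′|^{−α}|(∂^{L^{−j}}_μG_j(□)Q_j^*)(x, y) − (∂^{L^{−j}}_μG_j(□)Q_j^*)(x′, y)| ≤ c₁e^{−δ₀dist({x,x′},y)}, (2.36) […] for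
arbitrary non-negative integer j, arbitrary, rectangular parallelepiped □ ⊂ L^{−j}Z^d built of large blocks, and x, x′ ∈ □,
y, y′ ∈ □^{(j)} = □∩Z^d.»; p. 573: «there exist positive constants δ₀, c₀, R₀ independent of A, k, Ω and depending on d, M
only, c₀ on α also».  So IN PRINT the rate `δ₀` of (2.36) does not depend on `α`; only `c₁` does.

WHY THIS FILE.  The tree's theorems for (2.36) are stated `∀ α ∃ (κ, C)` — e.g. `B4StripSumsHolder.hkernel248_decay (hα0)
(hα1) : ∃ κ M, …` — although their PROOFS choose the rate independently of `α`: the root `holder248_stripRegular` takes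
`κ = min κ₁ (rOf (d+1))` with `κ₁` from the `α`-free `uniformStrip_holds` (only the bound `boundGH d α c m²₊` depends on `α`,
«finite only because α < 1»), and every later rate is a `min` of it with `α`-free rates.  The statement order propagates
upward through `…B4Thm19ZeroBoxHolder` to the [B6] Prop. 2.2 Hölder entries of the p21 lineage and forces the census
typing of [B6] Prop. 2.2 on multi-level families to be `∀ α ∃ δ₀(α)` (`…B6Prop22TwoLevelCensus.prop22_holderEntries_twoLevel`;
the reduction edge `…B6Prop22TwoLevelCensusUpTo.prop22Printed_twoLevel_of_holderUnif` waits for an `α`-uniform package).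
This file re-threads the FIRST FOUR links in print's order; the `…B4Thm19ZeroBoxHolder(Dual)` links and the p21 links are
the successor's (HOME `lit-balaban-r03/B6-CLOSURE.md` §3.7 v1.3 lists them).

WHAT THIS FILE PROVES (kernel-checked; 0 sorry; standard axioms; every proof is the original proof with the `∃`-witnesses
reordered — the `α`-free rate is produced BEFORE `α` is introduced, the `α`-dependent constant after):
* §1 `holder248_stripRegular_unif` — `∃ κ > 0 ∀ α ∈ [0,1) ∃ M ≥ 0`: `GH_{α,…}` is `StripRegular` on `Strip (d+1) κ` with
  bound `M`; `hkernel248_decay_unif` — the same order for `|latticeKernel GH (x)| ≤ Me^{−κ|x|_∞}`.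
* §2 `K_holder_decay_unif` — (2.36) at the kernel level (both one-sided fine steps, near displacements), `∃ κ ∀ α ∃ M`;
  `greenBoxQ_holder_decay_236_unif` — (2.36) for any right inverse `GB` of the box operator, `∃ κ ∀ α ∃ C`;
  `greenBoxQ_holder_decay_236_inv_unif` — the same, hypothesis-free, for `GB = (boxOp n a m2 M)⁻¹`.
HONEST SCOPE.  Exactly the scope of the originals (free propagator `A = 0`, near separations `0 < |x′−x|_∞ ≤ n` handled by
the Hölder multiplier and far ones by (2.35), windows `a ∈ [a₋, a₊]`, `m² ∈ [0, m²₊]`, `a₋ > 0`; `κ` depends on `(d, a₋, a₊,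
m²₊)`, `M`/`C` on these and `α`); no new estimate — a change of quantifier order justified by the existing proofs.  NOT
summit progress.
-/

noncomputable section

namespace Literature.MathematicalPhysics.QuantumFieldTheory.Balaban1983to89.B4Lemma24HolderRateUnif

open Finset Complex MeasureTheory
open Literature.MathematicalPhysics.QuantumFieldTheory.Balaban1983to89.B4ContourShift
open Literature.MathematicalPhysics.QuantumFieldTheory.Balaban1983to89.B4Reflection242
open Literature.MathematicalPhysics.QuantumFieldTheory.Balaban1983to89.B4Strip
open Literature.MathematicalPhysics.QuantumFieldTheory.Balaban1983to89.B4StripCauchy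
open Literature.MathematicalPhysics.QuantumFieldTheory.Balaban1983to89.B5Strip145Analytic
open Literature.MathematicalPhysics.QuantumFieldTheory.Balaban1983to89.B4StripSums
open Literature.MathematicalPhysics.QuantumFieldTheory.Balaban1983to89.B4StripSumsHolder
open Literature.MathematicalPhysics.QuantumFieldTheory.Balaban1983to89.B4Green242Bridge
open scoped Real

variable {d : ℕ}

/-! ## §1 The root: the strip width of the Hölder multiplier does not depend on `α` -/

/-- **[B4] LEMMA 2.4 (2.36), MULTIPLIER FORM, WITH THE RATE UNIFORM IN `α`** — `B4StripSumsHolder.holder248_stripRegular` re-threaded in print's quantifier order: ONE strip width `κ > 0` (depending on `d`, `a₋`, `a₊`, `m²₊` only: `κ = min κ₁ 1/(4(d+2))` with `κ₁` from the `α`-free `uniformStrip_holds`) such that FOR EVERY `0 ≤ α < 1` there is `M(α) ≥ 0` (`= boundGH d α …`, finite only because `α < 1`) with `GH_{α,n,a,m²,τ,μ,σ}` `StripRegular` on `Strip (d+1) κ` with bound `M(α)` for every scale, window point, offset, direction and near separation.  Same proof as the original, witnesses reordered; nothing else. [cite: Balaban1983RegularityDecay, Lemma 2.4 (2.36) p.582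 («There exist positive constants c₀, δ₀, and for α < 1, there exists a constant c₁»); (2.49)–(2.51) pp.585–586] -/
theorem holder248_stripRegular_unif (d : ℕ) (aminus aplus m2plus : ℝ) (ha : 0 < aminus) :
    ∃ κ : ℝ, 0 < κ ∧ ∀ (α : ℝ), 0 ≤ α → α < 1 → ∃ M : ℝ, 0 ≤ M ∧ ∀ (n : ℕ) [NeZero n] (a m2 : ℝ), aminus ≤ a → a ≤ aplus → 0 ≤ m2 →
      m2 ≤ m2plus → ∀ (τ : Fin (d + 1) → Fin n) (μ : Fin (d + 1)) (σ : Fin (d + 1) → ℤ), σ ≠ 0 →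
        (∀ ν, |σ ν| ≤ n) → StripRegular (d := d) (GH α n a m2 τ μ σ) κ M := by
  obtain ⟨κ₁, c, hκ₁, hc, h⟩ := uniformStrip_holds (d + 1) aminus aplus m2plus ha
  refine ⟨min κ₁ (rOf (d + 1)), lt_min hκ₁ (rOf_pos _), fun α hα0 hα1 => ⟨boundGH d α c (max m2plus 0),
    boundGH_nonneg _ α hc (le_max_right _ _), ?_⟩⟩
  intro n _ a m2 ha1 ha2 hm hmp τ μ σ hσ0 hσn
  have hκ0 : 0 ≤ min κ₁ (rOf (d + 1)) := (lt_min hκ₁ (rOf_pos _)).le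
  have hsub : Strip (d + 1) (min κ₁ (rOf (d + 1))) ⊆ Strip (d + 1) κ₁ := strip_mono (min_le_left _ _)
  exact stripRegular_GH n a m2 (max m2plus 0) hm (hmp.trans (le_max_left _ _)) τ μ hσ0 hσn hα0 hα1 hκ0
    (min_le_right _ _) hc (fun p hp => h n a m2 ha1 ha2 hm hmp p (hsub hp))

/-- **[B4] LEMMA 2.4 (2.36): `j`-UNIFORM AND `α`-UNIFORM EXPONENTIAL DECAY OF THE HÖLDER QUOTIENT OF THE KERNEL OF `∂^{L^{-j}}_μ G_jQ_j^*`** (free propagator, infinite lattice, near separations) — `hkernel248_decay` in print's order: `∃ κ > 0 ∀ α ∈ [0,1) ∃ M(α) ≥ 0 ∀ n, a, m², τ, μ, σ, x: |latticeKernel GH (x)| ≤ M(α)e^{−κ|x|_∞}`. [cite: Balaban1983RegularityDecay, Lemma 2.4 (2.36) p.582; (2.49)–(2.51) pp.585–586] -/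
theorem hkernel248_decay_unif (d : ℕ) (aminus aplus m2plus : ℝ) (ha : 0 < aminus) :
    ∃ κ : ℝ, 0 < κ ∧ ∀ (α : ℝ), 0 ≤ α → α < 1 → ∃ M : ℝ, 0 ≤ M ∧ ∀ (n : ℕ) [NeZero n] (a m2 : ℝ), aminus ≤ a → a ≤ aplus → 0 ≤ m2 →
      m2 ≤ m2plus → ∀ (τ : Fin (d + 1) → Fin n) (μ : Fin (d + 1)) (σ : Fin (d + 1) → ℤ), σ ≠ 0 →
        (∀ ν, |σ ν| ≤ n) → ∀ x : Fin (d + 1) → ℤ,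
          ‖latticeKernel (GH α n a m2 τ μ σ) x‖ ≤ M * Real.exp (-(κ * supNorm x)) := by
  obtain ⟨κ, hκ, hA⟩ := holder248_stripRegular_unif d aminus aplus m2plus ha
  refine ⟨κ, hκ, fun α hα0 hα1 => ?_⟩
  obtain ⟨M, hM, h⟩ := hA α hα0 hα1
  refine ⟨M, hM, ?_⟩
  intro n _ a m2 ha1 ha2 hm hmp τ μ σ hσ0 hσn x
  exact latticeKernel_decay (h n a m2 ha1 ha2 hm hmp τ μ σ hσ0 hσn) hκ.le x

/-! ## §2 The kernel-level and box-level forms of (2.36) with one rate for all `α` -/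

/-- **(2.36) AT THE KERNEL LEVEL, BOTH ONE-SIDED FINE STEPS, NEAR DISPLACEMENTS, RATE UNIFORM IN `α`** — `B4Green242Bridge.K_holder_decay` in print's order (`∃ κ ∀ α ∃ M(α)`; `M(α)` = the `α`-dependent bound times `e^{κ}` for the backward step). [cite: Balaban1983RegularityDecay, Lemma 2.4 (2.36) p. 582, p. 573, (2.49)–(2.51) pp. 585–586] -/
theorem K_holder_decay_unif (d : ℕ) (aminus aplus m2plus : ℝ) (ha : 0 < aminus) :
    ∃ κ : ℝ, 0 < κ ∧ ∀ (α : ℝ), 0 ≤ α → α < 1 → ∃ M : ℝ, 0 ≤ M ∧ ∀ (n : ℕ) [NeZero n] (a m2 : ℝ), aminus ≤ a → a ≤ aplus → 0 ≤ m2 →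
      m2 ≤ m2plus → ∀ (μ : Fin (d + 1)) (σ : Fin (d + 1) → ℤ), σ ≠ 0 → (∀ ν, |σ ν| ≤ n) →
      ∀ (z y : Fin (d + 1) → ℤ),
        ‖((((n : ℝ) / supNorm σ) ^ α : ℝ) : ℂ) * ((n : ℂ) *
            ((B4Green244.K n a m2 (z + σ + Pi.single μ 1) y - B4Green244.K n a m2 (z + σ) y)
              - (B4Green244.K n a m2 (z + Pi.single μ 1) y - B4Green244.K n a m2 z y)))‖
            ≤ M * Real.exp (-(κ * supNorm (B4Green244.coarse n z - y))) ∧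
        ‖((((n : ℝ) / supNorm σ) ^ α : ℝ) : ℂ) * ((n : ℂ) *
            ((B4Green244.K n a m2 (z + σ + Pi.single μ (-1)) y - B4Green244.K n a m2 (z + σ) y)
              - (B4Green244.K n a m2 (z + Pi.single μ (-1)) y - B4Green244.K n a m2 z y)))‖
            ≤ M * Real.exp (-(κ * supNorm (B4Green244.coarse n z - y))) := by
  obtain ⟨κ, hκ, hA⟩ := hkernel248_decay_unif d aminus aplus m2plus ha
  refine ⟨κ, hκ, fun α hα0 hα1 => ?_⟩
  obtain ⟨M, hM, h⟩ := hA α hα0 hα1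
  refine ⟨M * Real.exp κ, by positivity, ?_⟩
  intro n _ a m2 h1 h2 h3 h4 μ σ hσ0 hσn z y
  have hn : 1 ≤ n := Nat.one_le_iff_ne_zero.2 (NeZero.ne n)
  have ha' : 0 < a := lt_of_lt_of_le ha h1
  have fwd : ∀ w : Fin (d + 1) → ℤ,
      ‖((((n : ℝ) / supNorm σ) ^ α : ℝ) : ℂ) * ((n : ℂ) *
          ((B4Green244.K n a m2 (w + σ + B4Green244.e μ) y - B4Green244.K n a m2 (w + σ) y)
            - (B4Green244.K n a m2 (w + B4Green244.e μ) y - B4Green244.K n a m2 w y)))‖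
        ≤ M * Real.exp (-(κ * supNorm (B4Green244.coarse n w - y))) := by
    intro w
    rw [K_holder_dd n hn a m2 ha' h3 α w σ y μ]
    exact h n a m2 h1 h2 h3 h4 _ μ σ hσ0 hσn _
  have hM1 : M ≤ M * Real.exp κ := le_mul_of_one_le_right hM (Real.one_le_exp hκ.le)
  constructor
  · exact (fwd z).trans (mul_le_mul_of_nonneg_right hM1 (Real.exp_pos _).le)
  · obtain ⟨w, rfl⟩ : ∃ w, z = w + B4Green244.e μ := ⟨z - B4Green244.e μ, (sub_add_cancel _ _).symm⟩
    have hw : w + B4Green244.e μ + Pi.single μ (-1) = w := by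
      rw [add_assoc, B4Green244.e, ← Pi.single_add, add_neg_cancel, Pi.single_zero, add_zero]
    have hw' : w + B4Green244.e μ + σ + Pi.single μ (-1) = w + σ := by
      rw [add_right_comm w, add_assoc (w + σ), B4Green244.e, ← Pi.single_add, add_neg_cancel, Pi.single_zero,
        add_zero]
    rw [hw', hw, add_right_comm w (B4Green244.e μ) σ]
    have e1 : ((((n : ℝ) / supNorm σ) ^ α : ℝ) : ℂ) * ((n : ℂ) *
          ((B4Green244.K n a m2 (w + σ) y - B4Green244.K n a m2 (w + σ + B4Green244.e μ) y)
            - (B4Green244.K n a m2 w y - B4Green244.K n a m2 (w + B4Green244.e μ) y)))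
        = -(((((n : ℝ) / supNorm σ) ^ α : ℝ) : ℂ) * ((n : ℂ) *
          ((B4Green244.K n a m2 (w + σ + B4Green244.e μ) y - B4Green244.K n a m2 (w + σ) y)
            - (B4Green244.K n a m2 (w + B4Green244.e μ) y - B4Green244.K n a m2 w y)))) := by ring
    rw [e1, norm_neg]
    refine (fwd w).trans ?_
    have hs : supNorm (B4Green244.coarse n (w + B4Green244.e μ) - y) ≤ supNorm (B4Green244.coarse n w - y) + 1 := by
      have h' := supNorm_add_le (B4Green244.coarse n w - y)
        (B4Green244.coarse n (w + B4Green244.e μ) - B4Green244.coarse n w)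
      rw [show B4Green244.coarse n w - y + (B4Green244.coarse n (w + B4Green244.e μ) - B4Green244.coarse n w)
          = B4Green244.coarse n (w + B4Green244.e μ) - y by abel] at h'
      linarith [supNorm_coarse_add_e_sub_le n hn w μ]
    rw [mul_assoc, ← Real.exp_add]
    refine mul_le_mul_of_nonneg_left (Real.exp_le_exp.2 ?_) hM
    have := mul_le_mul_of_nonneg_left hs hκ.le
    linarith

/-- **(2.36) FOR `G_j(□)Q_j^*` ON A BOX, RATE UNIFORM IN `α`** — `B4Green242Bridge.greenBoxQ_holder_decay_236` in print's order: ONE `κ > 0` (`= min(κ₀/(d+1), κ₃)`, `κ₀ = min κ₁ κ₂` with `κ₁` from `B4Green244.K_decay`, `κ₂` from `K_holder_decay_unif`, `κ₃` from `greenBoxQ_deriv_decay_235` — all `α`-free) such that for every `0 ≤ α < 1` there is `C(α)` (`= C236 d κ₀ MHc(α) C₃`) with `(n/|x′ − x|_∞)^α‖n·Σ_{blk x″ = y}[(GB(xe′,x″) − GB(x′,x″)) − (GB(xe,x″) − GB(x,x″))]‖ ≤ C(α)e^{−κ·min(|blk x − y|_∞, |blk x′ − y|_∞)}` for every box, every right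 inverse `GB` of the box operator, every pair `x ≠ x′` with `μ`-neighbours in the box and every unit label `y`.  Proof = the original's (near pairs via `greenBoxQ_holder_src`, far pairs via (2.35)), with the `α`-dependent input taken from `K_holder_decay_unif`. [cite: Balaban1983RegularityDecay, p. 582 Lemma 2.4 (2.36) («(1/|x−x′|^α)|(∂_μ^{L^{−j}} G_j(□)Q_j^*)(x, y) − (∂_μ^{L^{−j}} G_j(□)Q_j^*)(x′, y)| ≤ c₁e^{−δ₀ dist({x,x′},y)}»), p. 573, p. 584 (2.42), (2.44), pp. 585–586 (2.49)–(2.51)] -/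
theorem greenBoxQ_holder_decay_236_unif (d : ℕ) (aminus aplus m2plus : ℝ) (ha : 0 < aminus) :
    ∃ κ : ℝ, 0 < κ ∧ ∀ (α : ℝ), 0 ≤ α → α < 1 → ∃ C : ℝ, 0 ≤ C ∧ ∀ (n : ℕ), 1 ≤ n → ∀ (a m2 : ℝ), aminus ≤ a → a ≤ aplus → 0 ≤ m2 → m2 ≤ m2plus →
      ∀ (M : Fin (d + 1) → ℕ), (∀ i, 1 ≤ M i) →
      ∀ (GB : Matrix ↥(boxDom (fun i => n * M i)) ↥(boxDom (fun i => n * M i)) ℂ),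
        (Matrix.of fun x y : ↥(boxDom (fun i => n * M i)) =>
            opBoxK ((n : ℂ) ^ 2) (m2 : ℂ) ((a : ℂ) * ((n : ℂ) ^ (d + 1))⁻¹) n (fun i => n * M i) x.1 y.1) * GB = 1 →
        ∀ (μ : Fin (d + 1)) (x xe x' xe' : ↥(boxDom (fun i => n * M i))), xe.1 = x.1 + Pi.single μ 1 →
          xe'.1 = x'.1 + Pi.single μ 1 → x'.1 ≠ x.1 →
        ∀ (y : Fin (d + 1) → ℤ), y ∈ boxDom M →
          ((n : ℝ) / supNorm (x'.1 - x.1)) ^ α *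
              ‖(n : ℂ) * ∑ x'' : ↥(boxDom (fun i => n * M i)),
                (if blk n x''.1 = y then (GB xe' x'' - GB x' x'') - (GB xe x'' - GB x x'') else 0)‖
            ≤ C * Real.exp (-(κ * min (supNorm (blk n x.1 - y)) (supNorm (blk n x'.1 - y)))) := by
  obtain ⟨κ₁, MK, hκ₁, hMK, hdec⟩ := B4Green244.K_decay d aminus aplus m2plus ha
  obtain ⟨κ₂, hκ₂, hholA⟩ := K_holder_decay_unif d aminus aplus m2plus ha
  obtain ⟨κ₃, C₃, hκ₃, hC₃, hfar⟩ := greenBoxQ_deriv_decay_235 d aminus aplus m2plus ha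
  obtain ⟨κ₀, hκ₀1, hκ₀2, hκ₀⟩ : ∃ κ₀, κ₀ ≤ κ₁ ∧ κ₀ ≤ κ₂ ∧ 0 < κ₀ :=
    ⟨min κ₁ κ₂, min_le_left _ _, min_le_right _ _, lt_min hκ₁ hκ₂⟩
  refine ⟨min (κ₀ / (d + 1)) κ₃, lt_min (by positivity) hκ₃, fun α hα0 hα1 => ?_⟩
  obtain ⟨MHc, hMHc, hhol⟩ := hholA α hα0 hα1
  have hC0 : 0 ≤ C235 d κ₀ MHc := C235_nonneg d hκ₀ hMHc
  refine ⟨C236 d κ₀ MHc C₃, by unfold C236; positivity, ?_⟩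
  intro n hn a m2 h1 h2 h3 h4 M hM GB hGB μ x xe x' xe' hxe hxe' hne y hy
  haveI : NeZero n := ⟨by omega⟩
  have ha' : 0 < a := lt_of_lt_of_le ha h1
  have hN : ∀ i, 1 ≤ (fun i => n * M i) i := fun i => Nat.one_le_iff_ne_zero.2 (Nat.mul_ne_zero_iff.2
    ⟨by omega, Nat.one_le_iff_ne_zero.1 (hM i)⟩)
  have hn0 : (0 : ℝ) < n := by exact_mod_cast hn
  -- the displacement `v = x′ − x ≠ 0`
  obtain ⟨v, hv⟩ : ∃ v : Fin (d + 1) → ℤ, x'.1 = x.1 + v := ⟨x'.1 - x.1, (add_sub_cancel _ _).symm⟩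
  have hvx : x'.1 - x.1 = v := by rw [hv, add_sub_cancel_left]
  have hv0 : v ≠ 0 := fun h0 => hne (by rw [hv, h0, add_zero])
  have hsn : 0 < supNorm v := lt_of_lt_of_le one_pos (one_le_supNorm hv0)
  rw [hvx]
  set c : ℝ := ((n : ℝ) / supNorm v) ^ α with hc
  have hc0 : 0 ≤ c := Real.rpow_nonneg (div_nonneg hn0.le hsn.le) α
  -- comparison of the exponential factors with the common one
  have hexp : ∀ {k k' t t' : ℝ}, k ≤ k' → t ≤ t' → 0 ≤ t → 0 ≤ k' →
      Real.exp (-(k' * t')) ≤ Real.exp (-(k * t)) :=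
    fun hk ht ht0 hk' => Real.exp_le_exp.2 (neg_le_neg (mul_le_mul hk ht ht0 hk'))
  have hm0 : 0 ≤ min (supNorm (blk n x.1 - y)) (supNorm (blk n x'.1 - y)) :=
    le_min (supNorm_nonneg _) (supNorm_nonneg _)
  have hE1 : Real.exp (-(κ₀ / (d + 1) * supNorm (blk n x.1 - y)))
      ≤ Real.exp (-(min (κ₀ / (d + 1)) κ₃ * min (supNorm (blk n x.1 - y)) (supNorm (blk n x'.1 - y)))) :=
    hexp (min_le_left _ _) (min_le_left _ _) hm0 (by positivity)
  have hE2 : Real.exp (-(κ₃ * supNorm (blk n x.1 - y)))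
      ≤ Real.exp (-(min (κ₀ / (d + 1)) κ₃ * min (supNorm (blk n x.1 - y)) (supNorm (blk n x'.1 - y)))) :=
    hexp (min_le_right _ _) (min_le_left _ _) hm0 hκ₃.le
  have hE3 : Real.exp (-(κ₃ * supNorm (blk n x'.1 - y)))
      ≤ Real.exp (-(min (κ₀ / (d + 1)) κ₃ * min (supNorm (blk n x.1 - y)) (supNorm (blk n x'.1 - y)))) :=
    hexp (min_le_right _ _) (min_le_right _ _) hm0 hκ₃.le
  set Ecom := Real.exp (-(min (κ₀ / (d + 1)) κ₃ * min (supNorm (blk n x.1 - y)) (supNorm (blk n x'.1 - y))))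
    with hEcom
  have hEcom0 : 0 ≤ Ecom := (Real.exp_pos _).le
  by_cases hnear : ∀ ν, |v ν| ≤ n
  · -- NEAR PAIRS: the Hölder kernel bound through the images
    have hcpos : 0 < c := Real.rpow_pos_of_pos (div_pos hn0 hsn) α
    have hweak : ∀ {κ : ℝ}, κ₀ ≤ κ → ∀ s : ℝ, 0 ≤ s → Real.exp (-(κ * s)) ≤ Real.exp (-(κ₀ * s)) :=
      fun hk s hs => Real.exp_le_exp.2 (neg_le_neg (mul_le_mul_of_nonneg_right hk hs))
    have hKdec : ∀ u w : Fin (d + 1) → ℤ, ‖B4Green244.K n a m2 u w‖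
        ≤ MK * Real.exp (-(κ₀ * supNorm (blk n u - w))) :=
      fun u w => (hdec n a m2 h1 h2 h3 h4 u w).trans
        (mul_le_mul_of_nonneg_left (hweak hκ₀1 _ (supNorm_nonneg _)) hMK)
    have hKhol : ∀ (ε : Fin (d + 1) → Bool) (u w : Fin (d + 1) → ℤ),
        ‖(B4Green244.K n a m2 (u + sflip ε v + Pi.single μ 1) w - B4Green244.K n a m2 (u + sflip ε v) w)
            - (B4Green244.K n a m2 (u + Pi.single μ 1) w - B4Green244.K n a m2 u w)‖
            ≤ MHc / (c * n) * Real.exp (-(κ₀ * supNorm (blk n u - w))) ∧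
        ‖(B4Green244.K n a m2 (u + sflip ε v + Pi.single μ (-1)) w - B4Green244.K n a m2 (u + sflip ε v) w)
            - (B4Green244.K n a m2 (u + Pi.single μ (-1)) w - B4Green244.K n a m2 u w)‖
            ≤ MHc / (c * n) * Real.exp (-(κ₀ * supNorm (blk n u - w))) := by
      intro ε u w
      obtain ⟨hf, hb⟩ := hhol n a m2 h1 h2 h3 h4 μ (sflip ε v) (sflip_ne_zero ε hv0)
        (fun ν => by rw [abs_sflip_apply]; exact hnear ν) u w
      rw [supNorm_sflip, ← hc] at hf hb
      have conv : ∀ {D : ℂ}, ‖((c : ℝ) : ℂ) * ((n : ℂ) * D)‖ ≤ MHc * Real.exp (-(κ₂ * supNorm (blk n u - w))) →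
          ‖D‖ ≤ MHc / (c * n) * Real.exp (-(κ₀ * supNorm (blk n u - w))) := by
        intro D hD
        rw [norm_mul, norm_mul, Complex.norm_real, Complex.norm_natCast, Real.norm_eq_abs, abs_of_nonneg hc0] at hD
        have hD' : c * (n * ‖D‖) ≤ MHc * Real.exp (-(κ₀ * supNorm (blk n u - w))) :=
          hD.trans (mul_le_mul_of_nonneg_left (hweak hκ₀2 _ (supNorm_nonneg _)) hMHc)
        rw [div_mul_eq_mul_div, le_div_iff₀ (mul_pos hcpos hn0)]
        linarith
      exact ⟨conv hf, conv hb⟩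
    have h := greenBoxQ_holder_src hn hM hN ((n : ℂ) ^ 2) (m2 : ℂ) ((a : ℂ) * ((n : ℂ) ^ (d + 1))⁻¹) hκ₀ hMK
      (div_nonneg hMHc (mul_pos hcpos hn0).le) (fun u w => green244_kernelForm n hn a m2 ha' h3 u w) hKdec μ v hKhol
      GB hGB x xe x' xe' hxe hv hxe' hy
    rw [norm_mul, Complex.norm_natCast]
    have h' := mul_le_mul_of_nonneg_left h (mul_pos hcpos hn0).le
    rw [show c * n * (MHc / (c * n) * boxConst κ₀ d M * Real.exp (-(κ₀ / (d + 1) * supNorm (blk n x.1 - y))))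
        = MHc * boxConst κ₀ d M * Real.exp (-(κ₀ / (d + 1) * supNorm (blk n x.1 - y))) by
          field_simp] at h'
    calc c * (n * ‖∑ x'' : ↥(boxDom (fun i => n * M i)),
            (if blk n x''.1 = y then (GB xe' x'' - GB x' x'') - (GB xe x'' - GB x x'') else 0)‖)
        = c * n * ‖∑ x'' : ↥(boxDom (fun i => n * M i)),
            (if blk n x''.1 = y then (GB xe' x'' - GB x' x'') - (GB xe x'' - GB x x'') else 0)‖ := by ring
      _ ≤ MHc * boxConst κ₀ d M * Real.exp (-(κ₀ / (d + 1) * supNorm (blk n x.1 - y))) := h'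
      _ ≤ C235 d κ₀ MHc * Real.exp (-(κ₀ / (d + 1) * supNorm (blk n x.1 - y))) := by
          unfold C235
          exact mul_le_mul_of_nonneg_right (mul_le_mul_of_nonneg_left (boxConst_le_one hκ₀ hM) hMHc)
            (Real.exp_pos _).le
      _ ≤ C235 d κ₀ MHc * Ecom := mul_le_mul_of_nonneg_left hE1 hC0
      _ ≤ C236 d κ₀ MHc C₃ * Ecom := by
          unfold C236
          exact mul_le_mul_of_nonneg_right (le_add_of_nonneg_right (by positivity)) hEcom0
  · -- FAR PAIRS: the weight is `≤ 1`; the two first differences separately by (2.35), second quantity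
    obtain ⟨ν, hν⟩ := not_forall.1 hnear
    have hν' : (n : ℤ) < |v ν| := not_le.1 hν
    have hsup : (n : ℝ) ≤ supNorm v := by
      have h1' : ((n : ℤ) : ℝ) ≤ ((|v ν| : ℤ) : ℝ) := Int.cast_le.2 hν'.le
      rw [Int.cast_natCast] at h1'
      exact h1'.trans (abs_le_supNorm v ν)
    have hc1 : c ≤ 1 := Real.rpow_le_one (div_nonneg hn0.le hsn.le) (div_le_one_of_le₀ hsup hsn.le) hα0
    have hsplit : ∑ x'' : ↥(boxDom (fun i => n * M i)),
          (if blk n x''.1 = y then (GB xe' x'' - GB x' x'') - (GB xe x'' - GB x x'') else 0)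
        = ∑ x'' : ↥(boxDom (fun i => n * M i)), (if blk n x''.1 = y then GB xe' x'' - GB x' x'' else 0)
          - ∑ x'' : ↥(boxDom (fun i => n * M i)), (if blk n x''.1 = y then GB xe x'' - GB x x'' else 0) := by
      rw [← Finset.sum_sub_distrib]
      refine Finset.sum_congr rfl fun x'' _ => ?_
      split_ifs <;> simp
    have hA := hfar n hn a m2 h1 h2 h3 h4 M hM GB hGB μ x' xe' hxe' y hy
    have hB := hfar n hn a m2 h1 h2 h3 h4 M hM GB hGB μ x xe hxe y hy
    rw [hsplit, mul_sub]
    calc c * ‖(n : ℂ) * ∑ x'' : ↥(boxDom (fun i => n * M i)), (if blk n x''.1 = y then GB xe' x'' - GB x' x'' else 0)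
            - (n : ℂ) * ∑ x'' : ↥(boxDom (fun i => n * M i)), (if blk n x''.1 = y then GB xe x'' - GB x x'' else 0)‖
        ≤ 1 * ‖(n : ℂ) * ∑ x'' : ↥(boxDom (fun i => n * M i)), (if blk n x''.1 = y then GB xe' x'' - GB x' x'' else 0)
            - (n : ℂ) * ∑ x'' : ↥(boxDom (fun i => n * M i)), (if blk n x''.1 = y then GB xe x'' - GB x x'' else 0)‖ :=
          mul_le_mul_of_nonneg_right hc1 (norm_nonneg _)
      _ ≤ ‖(n : ℂ) * ∑ x'' : ↥(boxDom (fun i => n * M i)), (if blk n x''.1 = y then GB xe' x'' - GB x' x'' else 0)‖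
            + ‖(n : ℂ) * ∑ x'' : ↥(boxDom (fun i => n * M i)), (if blk n x''.1 = y then GB xe x'' - GB x x'' else 0)‖ := by
          rw [one_mul]; exact norm_sub_le _ _
      _ ≤ C₃ * Real.exp (-(κ₃ * supNorm (blk n x'.1 - y))) + C₃ * Real.exp (-(κ₃ * supNorm (blk n x.1 - y))) :=
          add_le_add hA hB
      _ ≤ C₃ * Ecom + C₃ * Ecom := add_le_add (mul_le_mul_of_nonneg_left hE3 hC₃) (mul_le_mul_of_nonneg_left hE2 hC₃)
      _ = 2 * C₃ * Ecom := by ring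
      _ ≤ C236 d κ₀ MHc C₃ * Ecom := by
          unfold C236
          exact mul_le_mul_of_nonneg_right (le_add_of_nonneg_left hC0) hEcom0

/-- **(2.36) FOR `G_j(□)Q_j^*`, HYPOTHESIS-FREE, RATE UNIFORM IN `α`**: the same for the constructed box propagator `GB := (boxOp n a m2 M)⁻¹` — `B4Green242Bridge.greenBoxQ_holder_decay_236_inv` in print's order `∃ κ ∀ α ∃ C(α)`. [cite: Balaban1983RegularityDecay, p. 582 Lemma 2.4 (2.36), p. 573, p. 584 (2.44), pp. 585–586 (2.49)–(2.51)] -/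
theorem greenBoxQ_holder_decay_236_inv_unif (d : ℕ) (aminus aplus m2plus : ℝ) (ha : 0 < aminus) :
    ∃ κ : ℝ, 0 < κ ∧ ∀ (α : ℝ), 0 ≤ α → α < 1 → ∃ C : ℝ, 0 ≤ C ∧ ∀ (n : ℕ), 1 ≤ n → ∀ (a m2 : ℝ), aminus ≤ a → a ≤ aplus → 0 ≤ m2 → m2 ≤ m2plus →
      ∀ (M : Fin (d + 1) → ℕ), (∀ i, 1 ≤ M i) →
        boxOp n a m2 M * (boxOp n a m2 M)⁻¹ = 1 ∧
        ∀ (μ : Fin (d + 1)) (x xe x' xe' : ↥(boxDom (fun i => n * M i))), xe.1 = x.1 + Pi.single μ 1 →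
          xe'.1 = x'.1 + Pi.single μ 1 → x'.1 ≠ x.1 →
        ∀ (y : Fin (d + 1) → ℤ), y ∈ boxDom M →
          ((n : ℝ) / supNorm (x'.1 - x.1)) ^ α *
              ‖(n : ℂ) * ∑ x'' : ↥(boxDom (fun i => n * M i)),
                (if blk n x''.1 = y then ((boxOp n a m2 M)⁻¹ xe' x'' - (boxOp n a m2 M)⁻¹ x' x'')
                  - ((boxOp n a m2 M)⁻¹ xe x'' - (boxOp n a m2 M)⁻¹ x x'') else 0)‖
            ≤ C * Real.exp (-(κ * min (supNorm (blk n x.1 - y)) (supNorm (blk n x'.1 - y)))) := by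
  obtain ⟨κ, hκ, hA⟩ := greenBoxQ_holder_decay_236_unif d aminus aplus m2plus ha
  refine ⟨κ, hκ, fun α hα0 hα1 => ?_⟩
  obtain ⟨C, hC, h⟩ := hA α hα0 hα1
  refine ⟨C, hC, fun n hn a m2 h1 h2 h3 h4 M hM => ?_⟩
  have hinv : boxOp n a m2 M * (boxOp n a m2 M)⁻¹ = 1 := boxOp_mul_inv hn (lt_of_lt_of_le ha h1) h3 hM
  exact ⟨hinv, fun μ x xe x' xe' hxe hxe' hne y hy => h n hn a m2 h1 h2 h3 h4 M hM _ hinv μ x xe x' xe' hxe hxe' hne y hy⟩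
end Literature.MathematicalPhysics.QuantumFieldTheory.Balaban1983to89.B4Lemma24HolderRateUnif
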